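import Literature.Analysis.InverseSpectral.KreinString
import HarnessLib

/-!
# The string with a prescribed (monotone) mass profile

Given a length `ℓ ∈ (0, ∞]` and a function `g ≥ 0`, non-decreasing on `[0, ℓ)`, there is a Kreĭn
string `S = KreinString.ofProfile ℓ g` of length `ℓ` whose mass function is the right-continuous
regularisation of `g`: `g(y) ≤ m_S(y) ≤ g(y')` for `y < y'` in `[0, ℓ)` (`mass_ofProfile_ge`,
`mass_ofProfile_le`); in particular `m_S = g` at every point of right-continuity of `g`. The mass
measure is assembled from the Lebesgue–Stieltjes measures of the truncations `g(min(·, x_k))`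
along an exhaustion `x_k ↑ ℓ` (so that profiles exploding at a finite end are allowed). This is the
last ingredient of the compactness of the space of strings (Kotani–Watanabe 1982 §2) used in the
approximation proof of Kreĭn's existence theorem.

## References

KotaniWatanabe1982 (§2), KacKrein1974 (§11).
-/

open MeasureTheory Filter Set Topology Function
open scoped ENNReal

noncomputable section

namespace Literature.Analysis.InverseSpectral

namespace KreinString

namespace OfProfile

variable (ℓ : ℝ≥0∞) (g : ℝ → ℝ)

/-- The parameter interval `[0, ℓ)` as a set of reals. [folklore] -/
def D : Set ℝ := {y | 0 ≤ y ∧ ENNReal.ofReal y < ℓ}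

/-- An exhaustion `x_k ↑ ℓ` of `[0, ℓ)` by points of `[0, ℓ)`. [folklore] -/
def xs (k : ℕ) : ℝ := if ℓ = ⊤ then (k : ℝ) + 1 else ℓ.toReal * (1 - 1 / ((k : ℝ) + 2))

variable {ℓ}

/-- `x_k ≥ 0`. [folklore] -/
lemma xs_nonneg (k : ℕ) : 0 ≤ xs ℓ k := by
  unfold xs; split_ifs
  · positivity
  · have : (0 : ℝ) ≤ 1 - 1 / ((k : ℝ) + 2) := by
      rw [sub_nonneg, div_le_one (by positivity)]; linarith
    exact mul_nonneg ENNReal.toReal_nonneg this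

/-- `x_k ∈ [0, ℓ)`. [folklore] -/
lemma xs_mem (hℓ : 0 < ℓ) (k : ℕ) : xs ℓ k ∈ D ℓ := by
  refine ⟨xs_nonneg k, ?_⟩
  by_cases h : ℓ = ⊤
  · simp [h]
  · have hℓr : 0 < ℓ.toReal := ENNReal.toReal_pos hℓ.ne' h
    rw [ENNReal.ofReal_lt_iff_lt_toReal (xs_nonneg k) h]
    unfold xs
    rw [if_neg h]
    have : 0 < 1 / ((k : ℝ) + 2) := by positivity
    nlinarith

/-- `x_k` is strictly increasing. [folklore] -/
lemma xs_strictMono (hℓ : 0 < ℓ) : StrictMono (xs ℓ) := by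
  refine strictMono_nat_of_lt_succ (fun k => ?_)
  unfold xs; split_ifs with h
  · push_cast; linarith
  · have hℓr : 0 < ℓ.toReal := ENNReal.toReal_pos hℓ.ne' h
    apply mul_lt_mul_of_pos_left _ hℓr
    have h1 : (0 : ℝ) < (k : ℝ) + 2 := by positivity
    have h2 : (0 : ℝ) < ((k + 1 : ℕ) : ℝ) + 2 := by positivity
    rw [sub_lt_sub_iff_left, one_div_lt_one_div h2 h1]
    push_cast; linarith

/-- Every point of `[0, ℓ)` lies below some `x_k`. [folklore] -/
lemma exists_lt_xs {y : ℝ} (hy : y ∈ D ℓ) : ∃ k, y < xs ℓ k := by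
  unfold xs
  by_cases h : ℓ = ⊤
  · obtain ⟨k, hk⟩ := exists_nat_gt y
    exact ⟨k, by rw [if_pos h]; linarith⟩
  · have hℓr : y < ℓ.toReal := (ENNReal.ofReal_lt_iff_lt_toReal hy.1 h).1 hy.2
    have hℓ0 : 0 < ℓ.toReal := hy.1.trans_lt hℓr
    -- `ℓ (1 - 1/(k+2)) > y` as soon as `1/(k+2) < (ℓ - y)/ℓ`
    obtain ⟨k, hk⟩ := exists_nat_gt (ℓ.toReal / (ℓ.toReal - y))
    refine ⟨k, ?_⟩
    rw [if_neg h]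
    have h1 : (0 : ℝ) < (k : ℝ) + 2 := by positivity
    have h2 : 0 < ℓ.toReal - y := by linarith
    rw [div_lt_iff₀ h2] at hk
    have h3 : ℓ.toReal * (1 - 1 / ((k : ℝ) + 2)) = ℓ.toReal - ℓ.toReal / ((k : ℝ) + 2) := by ring
    rw [h3, lt_sub_comm, div_lt_iff₀ h1]
    nlinarith

variable (ℓ) in
/-- The truncated profiles `f_k(y) = g(min(y, x_k))` (`0` for `y < 0`). [folklore] -/
def trunc (k : ℕ) (y : ℝ) : ℝ := if y < 0 then 0 else g (min y (xs ℓ k))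

variable {g}

/-- `f_k = 0` on `(-∞,0)`. [folklore] -/
lemma trunc_of_neg {k : ℕ} {y : ℝ} (hy : y < 0) : trunc ℓ g k y = 0 := by
  unfold trunc; rw [if_pos hy]

/-- `f_k(y) = g(min(y, x_k))` for `y ≥ 0`. [folklore] -/
lemma trunc_of_nonneg {k : ℕ} {y : ℝ} (hy : 0 ≤ y) : trunc ℓ g k y = g (min y (xs ℓ k)) := by
  unfold trunc; rw [if_neg (not_lt.2 hy)]

/-- `min(y, x_k) ∈ [0, ℓ)` for `y ≥ 0`. [folklore] -/
lemma min_mem_D (hℓ : 0 < ℓ) {y : ℝ} (hy : 0 ≤ y) (k : ℕ) : min y (xs ℓ k) ∈ D ℓ :=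
  ⟨le_min hy (xs_nonneg k),
    lt_of_le_of_lt (ENNReal.ofReal_le_ofReal (min_le_right _ _)) (xs_mem hℓ k).2⟩

/-- The truncated profiles are monotone on all of `ℝ`. [folklore] -/
lemma monotone_trunc (hℓ : 0 < ℓ) (hg0 : ∀ y, 0 ≤ g y) (hgm : MonotoneOn g (D ℓ)) (k : ℕ) :
    Monotone (trunc ℓ g k) := by
  intro y y' hyy'
  rcases lt_or_ge y 0 with hy | hy
  · rw [trunc_of_neg hy]
    rcases lt_or_ge y' 0 with hy' | hy'
    · rw [trunc_of_neg hy']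
    · rw [trunc_of_nonneg hy']; exact hg0 _
  · have hy' : 0 ≤ y' := hy.trans hyy'
    rw [trunc_of_nonneg hy, trunc_of_nonneg hy']
    exact hgm (min_mem_D hℓ hy k) (min_mem_D hℓ hy' k) (min_le_min_right _ hyy')

/-- Two truncations agree up to the smaller truncation point. [folklore] -/
lemma trunc_eq_trunc {j k : ℕ} {y : ℝ} (hyj : y ≤ xs ℓ j) (hyk : y ≤ xs ℓ k) :
    trunc ℓ g j y = trunc ℓ g k y := by
  unfold trunc
  split_ifs
  · rfl
  · rw [min_eq_left hyj, min_eq_left hyk]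

variable (g) in
/-- The regularised profile `g₊(y) = lim_{y' ↓ y} g(y')`. [folklore] -/
def gplus (y : ℝ) : ℝ := rightLim (fun z => if z < 0 then 0 else g z) y

/-- Near points below `x_k`, the untruncated and truncated profiles agree. [folklore] -/
lemma eventuallyEq_trunc {k : ℕ} {y : ℝ} (hy : y < xs ℓ k) :
    (fun z => if z < 0 then 0 else g z) =ᶠ[𝓝[>] y] trunc ℓ g k := by
  have : Ioo y (xs ℓ k) ∈ 𝓝[>] y := Ioo_mem_nhdsGT hy
  filter_upwards [this] with z hz
  unfold trunc
  split_ifs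
  · rfl
  · rw [min_eq_left hz.2.le]

/-- `g₊ = rightLim f_k` below `x_k`. [folklore] -/
lemma gplus_eq_rightLim_trunc (hℓ : 0 < ℓ) (hg0 : ∀ y, 0 ≤ g y) (hgm : MonotoneOn g (D ℓ))
    {k : ℕ} {y : ℝ} (hy : y < xs ℓ k) : gplus g y = rightLim (trunc ℓ g k) y := by
  unfold gplus
  exact rightLim_eq_of_tendsto
    (((monotone_trunc hℓ hg0 hgm k).tendsto_rightLim y).congr' (eventuallyEq_trunc hy).symm)

section Build

variable (hℓ : 0 < ℓ) (hg0 : ∀ y, 0 ≤ g y) (hgm : MonotoneOn g (D ℓ))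
include hℓ hg0 hgm

/-- The Lebesgue–Stieltjes functions of the truncated profiles. [folklore] -/
def F (k : ℕ) : StieltjesFunction ℝ := (monotone_trunc hℓ hg0 hgm k).stieltjesFunction

/-- `F_k = rightLim f_k`. [folklore] -/
lemma F_apply (k : ℕ) (y : ℝ) : F hℓ hg0 hgm k y = rightLim (trunc ℓ g k) y :=
  Monotone.stieltjesFunction_eq _ y

/-- `F_k = 0` on `(-∞, 0)`. [folklore] -/
lemma F_of_neg (k : ℕ) {y : ℝ} (hy : y < 0) : F hℓ hg0 hgm k y = 0 := by
  rw [F_apply]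
  refine rightLim_eq_of_tendsto (tendsto_const_nhds.congr' ?_)
  filter_upwards [Ioo_mem_nhdsGT hy] with z hz
  exact (trunc_of_neg hz.2).symm

/-- `F_k(0-) = 0`. [folklore] -/
lemma leftLim_F_zero (k : ℕ) : leftLim (F hℓ hg0 hgm k) 0 = 0 := by
  refine leftLim_eq_of_tendsto (tendsto_const_nhds.congr' ?_)
  filter_upwards [self_mem_nhdsWithin] with z hz
  exact (F_of_neg hℓ hg0 hgm k hz).symm

/-- `F_k = g₊` below `x_k`. [folklore] -/
lemma F_eq_gplus (k : ℕ) {y : ℝ} (hy : y < xs ℓ k) : F hℓ hg0 hgm k y = gplus g y := by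
  rw [F_apply, gplus_eq_rightLim_trunc hℓ hg0 hgm hy]

/-- **Sandwich, lower**: `g(y) ≤ g₊(y)` on `[0, ℓ)`. [folklore] -/
lemma le_gplus {y : ℝ} (hy : y ∈ D ℓ) : g y ≤ gplus g y := by
  obtain ⟨k, hk⟩ := exists_lt_xs hy
  rw [gplus_eq_rightLim_trunc hℓ hg0 hgm hk]
  have h := (monotone_trunc hℓ hg0 hgm k).le_rightLim (le_refl y)
  rwa [trunc_of_nonneg hy.1, min_eq_left hk.le] at h

/-- **Sandwich, upper**: `g₊(y) ≤ g(y')` for `y < y'` in `[0, ℓ)`. [folklore] -/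
lemma gplus_le {y y' : ℝ} (hy : 0 ≤ y) (hyy' : y < y') (hy' : y' ∈ D ℓ) : gplus g y ≤ g y' := by
  obtain ⟨k, hk⟩ := exists_lt_xs hy'
  rw [gplus_eq_rightLim_trunc hℓ hg0 hgm (hyy'.trans hk)]
  have h := (monotone_trunc hℓ hg0 hgm k).rightLim_le hyy'
  rwa [trunc_of_nonneg (hy.trans hyy'.le), min_eq_left hk.le] at h

/-- `g₊ ≥ 0` on `[0, ∞)`. [folklore] -/
lemma gplus_nonneg {y : ℝ} (hy : y ∈ D ℓ) : 0 ≤ gplus g y :=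
  (hg0 y).trans (le_gplus hℓ hg0 hgm hy)

/-- `g₊` is non-decreasing on `[0, ℓ)`. [folklore] -/
lemma gplus_mono {y y' : ℝ} (hy' : y' ∈ D ℓ) (hyy' : y ≤ y') :
    gplus g y ≤ gplus g y' := by
  obtain ⟨k, hk⟩ := exists_lt_xs hy'
  rw [← F_eq_gplus hℓ hg0 hgm k (hyy'.trans_lt hk), ← F_eq_gplus hℓ hg0 hgm k hk]
  exact (F hℓ hg0 hgm k).mono hyy'

/-- The pieces of the exhaustion: `[0, x₀]`, `(x_{k-1}, x_k]`. [folklore] -/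
def piece (k : ℕ) : Set ℝ := if k = 0 then Icc 0 (xs ℓ 0) else Ioc (xs ℓ (k - 1)) (xs ℓ k)

omit hℓ hg0 hgm in
/-- The pieces are measurable. [folklore] -/
lemma measurableSet_piece (k : ℕ) : MeasurableSet (piece (ℓ := ℓ) k) := by
  unfold piece; split_ifs <;> measurability

omit hℓ hg0 hgm in
/-- Piece `k` lies in `[0, x_k]`. [folklore] -/
lemma piece_subset_Icc (k : ℕ) : piece (ℓ := ℓ) k ⊆ Icc 0 (xs ℓ k) := by
  unfold piece; split_ifs with h
  · subst h; exact Subset.rfl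
  · exact fun y hy => ⟨(xs_nonneg (k - 1)).trans hy.1.le, hy.2⟩

omit hℓ hg0 hgm in
/-- Piece `k ≥ 1` lies in `(x_{k-1}, ∞)`. [folklore] -/
lemma piece_subset_Ioi {k : ℕ} (hk : k ≠ 0) : piece (ℓ := ℓ) k ⊆ Ioi (xs ℓ (k - 1)) := by
  unfold piece; rw [if_neg hk]; exact fun y hy => hy.1

/-- **The mass measure of the profile**: the truncated Lebesgue–Stieltjes measures glued along
the exhaustion. [folklore] -/
def massMeasureOf : Measure ℝ :=
  Measure.sum (fun k => (F hℓ hg0 hgm (k + 1)).measure.restrict (piece (ℓ := ℓ) k))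

/-- Evaluation of the glued measure. [folklore] -/
lemma massMeasureOf_apply {A : Set ℝ} (hA : MeasurableSet A) :
    massMeasureOf hℓ hg0 hgm A = ∑' k, (F hℓ hg0 hgm (k + 1)).measure (piece (ℓ := ℓ) k ∩ A) := by
  unfold massMeasureOf
  rw [Measure.sum_apply _ hA]
  congr 1
  funext k
  rw [Measure.restrict_apply hA, inter_comm]

/-- No mass on `(-∞, 0)`. [folklore] -/
lemma massMeasureOf_Iio_zero : massMeasureOf hℓ hg0 hgm (Iio 0) = 0 := by
  rw [massMeasureOf_apply hℓ hg0 hgm measurableSet_Iio, ENNReal.tsum_eq_zero]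
  intro k
  have : piece (ℓ := ℓ) k ∩ Iio 0 = ∅ := by
    ext y
    simp only [mem_inter_iff, mem_Iio, mem_empty_iff_false, iff_false, not_and, not_lt]
    exact fun hy => (piece_subset_Icc k hy).1
  rw [this, measure_empty]

/-- No mass at or beyond `ℓ`. [folklore] -/
lemma massMeasureOf_Ici {y : ℝ} (hy : ℓ ≤ ENNReal.ofReal y) :
    massMeasureOf hℓ hg0 hgm (Ici y) = 0 := by
  rw [massMeasureOf_apply hℓ hg0 hgm measurableSet_Ici, ENNReal.tsum_eq_zero]
  intro k
  have hk : xs ℓ (k) < y := by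
    have h1 := (xs_mem hℓ k).2
    by_contra hle
    exact absurd (lt_of_lt_of_le h1 (hy.trans (ENNReal.ofReal_le_ofReal (not_lt.1 hle))))
      (lt_irrefl _)
  have : piece (ℓ := ℓ) k ∩ Ici y = ∅ := by
    ext z
    simp only [mem_inter_iff, mem_Ici, mem_empty_iff_false, iff_false, not_and, not_le]
    exact fun hz => (piece_subset_Icc k hz).2.trans_lt hk
  rw [this, measure_empty]

end Build

section Value

variable (hℓ : 0 < ℓ) (hg0 : ∀ y, 0 ≤ g y) (hgm : MonotoneOn g (D ℓ))
include hℓ hg0 hgm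

omit hℓ hg0 hgm in
/-- Telescoping of `ofReal` increments of a monotone sequence. [folklore] -/
lemma telescope {c : ℕ → ℝ} (hc0 : 0 ≤ c 0) (hc : Monotone c) (n : ℕ) :
    ENNReal.ofReal (c 0) + ∑ j ∈ Finset.range n, ENNReal.ofReal (c (j + 1) - c j) =
      ENNReal.ofReal (c n) := by
  induction n with
  | zero => simp
  | succ n ih =>
    rw [Finset.sum_range_succ, ← add_assoc, ih,
      ← ENNReal.ofReal_add (hc0.trans (hc (Nat.zero_le n))) (sub_nonneg.2 (hc (Nat.le_succ n)))]
    congr 1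
    ring

/-- The measure of the full piece `k`: the increment of `g₊` over the piece. [folklore] -/
lemma measure_piece_zero :
    (F hℓ hg0 hgm 1).measure (piece (ℓ := ℓ) 0) = ENNReal.ofReal (gplus g (xs ℓ 0)) := by
  unfold piece
  rw [if_pos rfl, StieltjesFunction.measure_Icc, leftLim_F_zero, sub_zero,
    F_eq_gplus hℓ hg0 hgm 1 (xs_strictMono hℓ (Nat.lt_succ_self 0))]

/-- The measure of the full piece `j+1`. [folklore] -/
lemma measure_piece_succ (j : ℕ) :
    (F hℓ hg0 hgm (j + 2)).measure (piece (ℓ := ℓ) (j + 1)) =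
      ENNReal.ofReal (gplus g (xs ℓ (j + 1)) - gplus g (xs ℓ j)) := by
  unfold piece
  rw [if_neg (Nat.succ_ne_zero j), Nat.add_sub_cancel, StieltjesFunction.measure_Ioc,
    F_eq_gplus hℓ hg0 hgm _ (xs_strictMono hℓ (by omega)),
    F_eq_gplus hℓ hg0 hgm _ (xs_strictMono hℓ (by omega))]

/-- **The mass of `[0, y]` is `g₊(y)`** for `y ∈ [0, ℓ)`. [folklore] -/
theorem massMeasureOf_Iic {y : ℝ} (hy : y ∈ D ℓ) :
    massMeasureOf hℓ hg0 hgm (Iic y) = ENNReal.ofReal (gplus g y) := by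
  classical
  have hex : ∃ k, y ≤ xs ℓ k := (exists_lt_xs hy).imp (fun k hk => hk.le)
  set K := Nat.find hex with hK
  have hyK : y ≤ xs ℓ K := Nat.find_spec hex
  have hlt : ∀ k < K, xs ℓ k < y := fun k hk => not_le.1 (Nat.find_min hex hk)
  rw [massMeasureOf_apply hℓ hg0 hgm measurableSet_Iic]
  -- only the pieces `k ≤ K` meet `(-∞, y]`
  have hzero : ∀ k ∉ Finset.range (K + 1),
      (F hℓ hg0 hgm (k + 1)).measure (piece (ℓ := ℓ) k ∩ Iic y) = 0 := by
    intro k hk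
    rw [Finset.mem_range, not_lt] at hk
    have hk0 : k ≠ 0 := by omega
    have : piece (ℓ := ℓ) k ∩ Iic y = ∅ := by
      ext z
      simp only [mem_inter_iff, mem_Iic, mem_empty_iff_false, iff_false, not_and, not_le]
      intro hz
      have h1 := piece_subset_Ioi hk0 hz
      exact hyK.trans_lt ((xs_strictMono hℓ).monotone (by omega) |>.trans_lt h1)
    rw [this, measure_empty]
  rw [tsum_eq_sum hzero]
  -- the pieces `k < K` are entirely below `y`, the piece `K` is cut at `y`
  have hfull : ∀ k < K, piece (ℓ := ℓ) k ∩ Iic y = piece (ℓ := ℓ) k := fun k hk =>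
    inter_eq_left.2 (fun z hz => (piece_subset_Icc k hz).2.trans (hlt k hk).le)
  rcases Nat.eq_zero_or_pos K with hK0 | hKpos
  · -- `K = 0`: a single cut piece `[0, y]`
    rw [hK0, zero_add, Finset.sum_range_one]
    have : piece (ℓ := ℓ) 0 ∩ Iic y = Icc 0 y := by
      unfold piece; rw [if_pos rfl]
      ext z; simp only [mem_inter_iff, mem_Icc, mem_Iic]
      constructor
      · rintro ⟨⟨h1, -⟩, h2⟩; exact ⟨h1, h2⟩
      · rintro ⟨h1, h2⟩; exact ⟨⟨h1, h2.trans (hK0 ▸ hyK)⟩, h2⟩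
    rw [this, StieltjesFunction.measure_Icc, leftLim_F_zero, sub_zero,
      F_eq_gplus hℓ hg0 hgm 1 (lt_of_le_of_lt (hK0 ▸ hyK) (xs_strictMono hℓ (Nat.lt_succ_self 0)))]
  · -- `K = K' + 1`
    obtain ⟨K', hK'⟩ : ∃ K', K = K' + 1 := ⟨K - 1, by omega⟩
    rw [hK'] at hyK hlt hfull ⊢
    rw [Finset.sum_range_succ, Finset.sum_range_succ']
    -- full pieces
    have h0 : (F hℓ hg0 hgm (0 + 1)).measure (piece (ℓ := ℓ) 0 ∩ Iic y) =
        ENNReal.ofReal (gplus g (xs ℓ 0)) := by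
      rw [hfull 0 (by omega), zero_add, measure_piece_zero hℓ hg0 hgm]
    have hj : ∀ j ∈ Finset.range K',
        (F hℓ hg0 hgm (j + 1 + 1)).measure (piece (ℓ := ℓ) (j + 1) ∩ Iic y) =
        ENNReal.ofReal (gplus g (xs ℓ (j + 1)) - gplus g (xs ℓ j)) := by
      intro j hj
      rw [Finset.mem_range] at hj
      rw [hfull (j + 1) (by omega), show j + 1 + 1 = j + 2 by ring, measure_piece_succ hℓ hg0 hgm j]
    -- the cut piece
    have hcut : (F hℓ hg0 hgm (K' + 1 + 1)).measure (piece (ℓ := ℓ) (K' + 1) ∩ Iic y) =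
        ENNReal.ofReal (gplus g y - gplus g (xs ℓ K')) := by
      have : piece (ℓ := ℓ) (K' + 1) ∩ Iic y = Ioc (xs ℓ K') y := by
        unfold piece; rw [if_neg (Nat.succ_ne_zero K'), Nat.add_sub_cancel]
        ext z; simp only [mem_inter_iff, mem_Ioc, mem_Iic]
        constructor
        · rintro ⟨⟨h1, -⟩, h2⟩; exact ⟨h1, h2⟩
        · rintro ⟨h1, h2⟩; exact ⟨⟨h1, h2.trans hyK⟩, h2⟩
      rw [this, StieltjesFunction.measure_Ioc,
        F_eq_gplus hℓ hg0 hgm _ (hyK.trans_lt (xs_strictMono hℓ (by omega))),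
        F_eq_gplus hℓ hg0 hgm _ (xs_strictMono hℓ (by omega))]
    -- telescoping
    have hmono : Monotone (fun k => gplus g (xs ℓ k)) := fun a b hab =>
      gplus_mono hℓ hg0 hgm (xs_mem hℓ b) ((xs_strictMono hℓ).monotone hab)
    have htel := telescope (c := fun k => gplus g (xs ℓ k)) (gplus_nonneg hℓ hg0 hgm (xs_mem hℓ 0))
      hmono K'
    have hle : gplus g (xs ℓ K') ≤ gplus g y := gplus_mono hℓ hg0 hgm hy (hlt K' (by omega)).le
    rw [h0, Finset.sum_congr rfl hj, hcut, add_comm (∑ j ∈ Finset.range K', _) (ENNReal.ofReal _),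
      htel, ← ENNReal.ofReal_add (gplus_nonneg hℓ hg0 hgm (xs_mem hℓ K')) (sub_nonneg.2 hle)]
    congr 1
    ring

end Value

end OfProfile

open OfProfile in
/-- **The string with length `ℓ` and mass profile `g`** (regularised to be right-continuous).
[cite: KotaniWatanabe1982, §2] -/
def ofProfile (ℓ : ℝ≥0∞) (hℓ : 0 < ℓ) (g : ℝ → ℝ) (hg0 : ∀ y, 0 ≤ g y)
    (hgm : MonotoneOn g (OfProfile.D ℓ)) : KreinString where
  length := ℓ
  length_pos := hℓ
  massMeasure := massMeasureOf hℓ hg0 hgm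
  massMeasure_Iio_zero := massMeasureOf_Iio_zero hℓ hg0 hgm
  massMeasure_Iic_lt_top := fun x hx => by
    rcases lt_or_ge x 0 with hx0 | hx0
    · exact lt_of_le_of_lt (measure_mono (fun z hz => lt_of_le_of_lt hz hx0))
        ((massMeasureOf_Iio_zero hℓ hg0 hgm).le.trans_lt ENNReal.zero_lt_top)
    · rw [massMeasureOf_Iic hℓ hg0 hgm ⟨hx0, hx⟩]
      exact ENNReal.ofReal_lt_top
  massMeasure_Ici_eq_zero := fun x hx => massMeasureOf_Ici hℓ hg0 hgm hx

section API

variable {ℓ : ℝ≥0∞} (hℓ : 0 < ℓ) {g : ℝ → ℝ} (hg0 : ∀ y, 0 ≤ g y)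
  (hgm : MonotoneOn g (OfProfile.D ℓ))

/-- The length of `ofProfile` is `ℓ`. [folklore] -/
@[simp] lemma length_ofProfile : (ofProfile ℓ hℓ g hg0 hgm).length = ℓ := rfl

/-- The parameter interval of `ofProfile` is `[0, ℓ)`. [folklore] -/
lemma mem_dom_ofProfile {y : ℝ} : y ∈ (ofProfile ℓ hℓ g hg0 hgm).dom ↔ y ∈ OfProfile.D ℓ := Iff.rfl

/-- **The mass function of `ofProfile` is `g₊`.** [folklore] -/
theorem mass_ofProfile {y : ℝ} (hy : y ∈ OfProfile.D ℓ) :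
    (ofProfile ℓ hℓ g hg0 hgm).mass y = OfProfile.gplus g y := by
  rw [mass_def]
  show (OfProfile.massMeasureOf hℓ hg0 hgm (Iic y)).toReal = _
  rw [OfProfile.massMeasureOf_Iic hℓ hg0 hgm hy,
    ENNReal.toReal_ofReal (OfProfile.gplus_nonneg hℓ hg0 hgm hy)]

/-- **Sandwich, lower**: `g(y) ≤ m(y)` on `[0, ℓ)`. [cite: KotaniWatanabe1982, §2] -/
theorem le_mass_ofProfile {y : ℝ} (hy : y ∈ OfProfile.D ℓ) :
    g y ≤ (ofProfile ℓ hℓ g hg0 hgm).mass y := by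
  rw [mass_ofProfile hℓ hg0 hgm hy]
  exact OfProfile.le_gplus hℓ hg0 hgm hy

/-- **Sandwich, upper**: `m(y) ≤ g(y')` for `y < y'` in `[0, ℓ)`. [cite: KotaniWatanabe1982, §2] -/
theorem mass_ofProfile_le {y y' : ℝ} (hy : y ∈ OfProfile.D ℓ) (hyy' : y < y')
    (hy' : y' ∈ OfProfile.D ℓ) : (ofProfile ℓ hℓ g hg0 hgm).mass y ≤ g y' := by
  rw [mass_ofProfile hℓ hg0 hgm hy]
  exact OfProfile.gplus_le hℓ hg0 hgm hy.1 hyy' hy'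

/-- At points of right-continuity of `g` (within `[0, ℓ)`), `m = g`. [folklore] -/
theorem mass_ofProfile_eq_of_continuousWithinAt {y : ℝ} (hy : y ∈ OfProfile.D ℓ)
    (hc : ContinuousWithinAt g (Ioi y) y) : (ofProfile ℓ hℓ g hg0 hgm).mass y = g y := by
  refine le_antisymm ?_ (le_mass_ofProfile hℓ hg0 hgm hy)
  -- `m(y) ≤ g(y')` for all `y' ↓ y`, and `g(y') → g(y)`
  have hev : ∀ᶠ y' in 𝓝[>] y, (ofProfile ℓ hℓ g hg0 hgm).mass y ≤ g y' := by
    obtain ⟨k, hk⟩ := OfProfile.exists_lt_xs hy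
    filter_upwards [Ioo_mem_nhdsGT hk] with y' hy'
    exact mass_ofProfile_le hℓ hg0 hgm hy hy'.1
      ⟨hy.1.trans hy'.1.le, (ENNReal.ofReal_le_ofReal hy'.2.le).trans_lt (OfProfile.xs_mem hℓ k).2⟩
  exact ge_of_tendsto hc hev

end API

end KreinString

end Literature.Analysis.InverseSpectral

end
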